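import Literature.Analysis.FluidPDE.PassiveVectorTensorPropagatorLossMonotone
import HarnessLib

/-!
# The passive-vector propagator of a TIME-PERIODIC carrier commutes with the period shift

Analysis/FluidPDE proof-support file (theorems only; no definitions, no named facts).  For the solution propagator
`Torus.IsPropagator T b 𝔸 U` (constant tensor `NearIso 𝔸 lo hi`, `0 < lo`, bounded a.e. divergence-free carrier `b`) whose carrier is
`P`-periodic in time (`b (τ + P) = b τ`, `0 ≤ P ≤ T`):

* `IsPropagator.periodicShift` — the shifted family `(s, t) ↦ U (s + P) (t + P)` is again a propagator of the SAME carrier on the horizon `T − P`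
  (every axiom of `IsPropagator` transfers along the shift; the representation axiom because a weak solution on the window from `s` along
  `b(s + ·) = b(s + P + ·)` is a weak solution on the window from `s + P`);
* `IsPropagator.apply_add_period` — hence, by uniqueness of the propagator (`IsPropagator.eq_of_isPropagator`),
  **`U (s + P) (t + P) y = U s t y`** for `0 ≤ s ≤ t`, `t + P ≤ T`;
* `IsPropagator.apply_add_nat_mul_period` — and `U (s + jP) (t + jP) y = U s t y` for every `j : ℕ` with `t + jP ≤ T`.

This is the time-PHASE reduction (R-f) of the (V_mod) flat blocks of K1L_D (stmt-AnomalousDissipation-27980; certifier table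
`Cruxes/LagrangianRenormalisationStep/Lines/onelevel-ss-regimes.md` §1 (R-f), open item O-3): the cell carrier `cellField W M hM ν n` is periodic of
period `M·W.period/ν`, so phase-anchored window bounds transfer to every window starting at a multiple of the period.
[cite: Pazy1983, Ch. 5 §5.1 Def. 5.3, Thm. 5.3] [cite: LionsMagenes1972, Chap. 3 Thm. 1.1]

## Mathlib / tree search
Tree: `PassiveVectorTensorPropagator` (`IsPropagator`), `…PropagatorUnique` (`eq_of_isPropagator`), `…PropagatorLossMonotone`
(`IsPropagator.of_horizon_le`, the pattern for a derived propagator).  Mathlib: `ContinuousOn.comp`, `continuous_add_right`.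
-/

open MeasureTheory Set Filter Topology UnitAddTorus Function
open scoped ENNReal NNReal InnerProductSpace

noncomputable section

namespace Literature.Analysis.FluidPDE

namespace Torus

open FunctionSpaces.Torus FunctionSpaces

variable {d : Type*} [Fintype d] [DecidableEq d] [Nonempty d]
variable {T : ℝ} {𝔸 : Visc4 d} {lo hi : ℝ} {b : ℝ → UnitAddTorus d → EuclideanSpace ℝ d}
  {U : ℝ → ℝ → (Lp (EuclideanSpace ℝ d) 2 (volume : Measure (UnitAddTorus d)) →L[ℝ]
    Lp (EuclideanSpace ℝ d) 2 (volume : Measure (UnitAddTorus d)))}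

omit [Nonempty d] in
/-- **The period shift of the propagator of a periodic carrier is a propagator of the same carrier** (horizon `T − P`).
[cite: Pazy1983, Ch. 5 §5.1 Def. 5.3] -/
theorem IsPropagator.periodicShift (hU : IsPropagator T b 𝔸 U) {P : ℝ} (hP : 0 ≤ P) (hper : ∀ τ, b (τ + P) = b τ) :
    IsPropagator (T - P) b 𝔸 (fun s t => U (s + P) (t + P)) where
  norm_le := fun s t y => hU.norm_le _ _ y
  comp := fun s t r hs hst htr hrT y =>
    hU.comp (s + P) (t + P) (r + P) (by linarith) (by linarith) (by linarith) (by linarith) y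
  self_of_divFree := fun s hs hsT y hy => hU.self_of_divFree (s + P) (by linarith) (by linarith) y hy
  divFree := fun s t y => hU.divFree _ _ y
  eq_zero_of_orth := fun s t y h => hU.eq_zero_of_orth _ _ y h
  continuousOn := fun s hs hsT y z => by
    have hc := hU.continuousOn (s + P) (by linarith) (by linarith) y z
    exact hc.comp (continuous_id.add continuous_const).continuousOn fun t ht => ⟨by linarith [ht.1], by linarith [ht.2]⟩
  repr := by
    intro s hs hsT φ hφ hφdiv w hw
    have e : (fun τ => b (s + τ)) = fun τ => b (s + P + τ) := by
      funext τ; rw [show s + P + τ = (s + τ) + P by ring, hper]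
    rw [e] at hw
    have hT' : T - P - s = T - (s + P) := by ring
    rw [hT'] at hw ⊢
    have h := hU.repr (s + P) (by linarith) (by linarith) φ hφ hφdiv w hw
    filter_upwards [h] with τ hτ
    obtain ⟨hm, he⟩ := hτ
    exact ⟨hm, by rw [he, show s + P + τ = s + τ + P by ring]⟩

omit [Nonempty d] in
/-- **THE PROPAGATOR OF A PERIODIC CARRIER COMMUTES WITH THE PERIOD SHIFT**: `U (s + P) (t + P) y = U s t y` for `0 ≤ s ≤ t`, `t + P ≤ T`
(uniqueness of the propagator applied to `periodicShift`). [cite: Pazy1983, Ch. 5 §5.1 Thm. 5.3] [cite: LionsMagenes1972, Chap. 3 Thm. 1.1] -/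
theorem IsPropagator.apply_add_period (hU : IsPropagator T b 𝔸 U) (h𝔸 : NearIso 𝔸 lo hi) (hlo : 0 < lo)
    (hb : MemLp (stLift b) ∞ (volume.restrict (Ioo 0 T ×ˢ univ)))
    (hbdiv : ∀ᵐ τ ∂(volume.restrict (Ioo 0 T)), FunctionSpaces.Torus.IsWeaklyDivFree (b τ))
    {P : ℝ} (hP : 0 ≤ P) (hper : ∀ τ, b (τ + P) = b τ)
    {s t : ℝ} (hs : 0 ≤ s) (hst : s ≤ t) (htP : t + P ≤ T) (y : Lp (EuclideanSpace ℝ d) 2 (volume : Measure (UnitAddTorus d))) :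
    U (s + P) (t + P) y = U s t y := by
  have hU' := hU.periodicShift hP hper
  have hPT : T - P ≤ T := by linarith
  have hUT : IsPropagator (T - P) b 𝔸 U := hU.of_horizon_le h𝔸 hlo hb hbdiv hPT
  have hsub : Ioo 0 (T - P) ×ˢ (univ : Set (EuclideanSpace ℝ d)) ⊆ Ioo 0 T ×ˢ univ :=
    prod_mono (Ioo_subset_Ioo le_rfl hPT) subset_rfl
  have hbT : MemLp (stLift b) ∞ (volume.restrict (Ioo 0 (T - P) ×ˢ univ)) := hb.mono_measure (Measure.restrict_mono hsub le_rfl)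
  have hbdivT : ∀ᵐ τ ∂(volume.restrict (Ioo 0 (T - P))), FunctionSpaces.Torus.IsWeaklyDivFree (b τ) :=
    ae_restrict_of_ae_restrict_of_subset (Ioo_subset_Ioo le_rfl hPT) hbdiv
  exact (hUT.eq_of_isPropagator hU' h𝔸 hlo hbT hbdivT hs hst (by linarith) y).symm

omit [Nonempty d] in
/-- **Iterated period shifts**: `U (s + jP) (t + jP) y = U s t y` for `j : ℕ`, `0 ≤ s ≤ t`, `t + jP ≤ T`.
[cite: Pazy1983, Ch. 5 §5.1 Thm. 5.3] -/
theorem IsPropagator.apply_add_nat_mul_period (hU : IsPropagator T b 𝔸 U) (h𝔸 : NearIso 𝔸 lo hi) (hlo : 0 < lo)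
    (hb : MemLp (stLift b) ∞ (volume.restrict (Ioo 0 T ×ˢ univ)))
    (hbdiv : ∀ᵐ τ ∂(volume.restrict (Ioo 0 T)), FunctionSpaces.Torus.IsWeaklyDivFree (b τ))
    {P : ℝ} (hP : 0 ≤ P) (hper : ∀ τ, b (τ + P) = b τ) (j : ℕ)
    {s t : ℝ} (hs : 0 ≤ s) (hst : s ≤ t) (htP : t + j * P ≤ T) (y : Lp (EuclideanSpace ℝ d) 2 (volume : Measure (UnitAddTorus d))) :
    U (s + j * P) (t + j * P) y = U s t y := by
  induction j generalizing s t with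
  | zero => simp
  | succ j ih =>
    have hjP : 0 ≤ (j : ℝ) * P := by positivity
    have e1 : s + ((j + 1 : ℕ) : ℝ) * P = (s + j * P) + P := by push_cast; ring
    have e2 : t + ((j + 1 : ℕ) : ℝ) * P = (t + j * P) + P := by push_cast; ring
    have htP' : t + j * P + P ≤ T := by
      have : ((j + 1 : ℕ) : ℝ) * P = j * P + P := by push_cast; ring
      linarith
    rw [e1, e2, hU.apply_add_period h𝔸 hlo hb hbdiv hP hper (by linarith) (by linarith) htP' y]
    exact ih hs hst (by linarith)

end Torus

end Literature.Analysis.FluidPDE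

end
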